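import Literature.AlgebraicGeometry.Motives.ToProjFunctionField
import Literature.AlgebraicGeometry.Motives.ProjectiveOfAmpleDivisor
import HarnessLib

/-!
# Forms evaluated on generating sections: `F(s₀, …, s_N)` and its non-vanishing locus
# `X_{F(s)} = ψ⁻¹ D₊(F)`

Let `E` be a Cartier divisor on an integral `K`-scheme `X` and `s₀, …, s_N ∈ Γ(X, 𝒪_X(E))` global
sections whose non-vanishing loci cover `X`, so that they define a `K`-morphism
`ψ : X → ℙ^N_K` (`CartierDivisor.toGeneratingSections`, `GeneratingSections.toProj`;
Görtz–Wedhorn I, (13.12), Hartshorne II Thm. 7.1). For a form `F ∈ K[x₀, …, x_N]_e` this file proves: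

* `CartierDivisor.isSection_aeval` — `F(s) = F(s₀, …, s_N) ∈ Γ(X, 𝒪_X(e E))` (sections form a
  graded `K`-algebra);
* `CartierDivisor.mem_nonvanishing_aeval_iff` — **`X_{F(s)} = ψ⁻¹ D₊(F)`**: a point `x` lies in the
  non-vanishing locus of the section `F(s)` of `𝒪_X(e E)` iff `F` is not in the homogeneous prime
  `ψ(x)` (`e ≥ 1`); read in the chart `X_{s_j} → D₊(x_j)`, both say that `F(s)/s_jᵉ = F(s₀/s_j, …)`
  is a unit at `x` (Görtz–Wedhorn I, (13.11), p. 495: `r⁻¹(D₊(f)) = X_f` for the morphism `r` to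
  `Proj ⊕ Γ(X, 𝓛^{⊗d})`);
* `CartierDivisor.nonvanishingOpens_aeval_eq_preimage`, `isAffineOpen_nonvanishingOpens_aeval` —
  hence `X_{F(s)}` is affine as soon as `ψ` is an affine morphism (e.g. all `X_{s_j}` affine,
  `GeneratingSections.isAffineHom_toProj`), `D₊(F)` being affine.

These are the inputs for Noether normalisation of `(X, E)` by forms of high degree
(`Motives/ProjectiveNoetherNormalization`).

## References

* U. Görtz, T. Wedhorn, *Algebraic Geometry I: Schemes*, 2nd ed. (2020): (13.8) and (13.11), p. 495
  (`r⁻¹(D₊(f)) = X_f` for `r : X → ℙ`), Prop. 13.47 and its proof, (13.12). [GortzWedhorn2020]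
* R. Hartshorne, *Algebraic Geometry*, GTM 52 (1977), II Thm. 7.1. [Hartshorne1977]
-/

universe u

open CategoryTheory AlgebraicGeometry Limits HomogeneousLocalization TopologicalSpace Opposite
open MvPolynomial (C aeval eval₂ eval₂Hom monomial)
open Literature.AlgebraicGeometry.Motives.Segre Literature.AlgebraicGeometry.Motives.RatFn

attribute [local instance] MvPolynomial.gradedAlgebra

noncomputable section

namespace Literature.AlgebraicGeometry.Motives

namespace CartierDivisor

variable {K : Type u} [Field K] {X : Scheme.{u}} [IsIntegral X] [X.Over (Spec (.of K))]
  {E : CartierDivisor X} {N : ℕ} {s : Fin (N + 1) → X.functionField}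

/-! ### Forms on sections are sections -/

/-- **Sections form a graded `K`-algebra**: for a form `F` of degree `e` and sections
`s₀, …, s_N ∈ Γ(X, 𝒪_X(E))`, `F(s₀, …, s_N) ∈ Γ(X, 𝒪_X(e E))` (Görtz–Wedhorn I, (13.11): the graded ring
`⊕ Γ(X, 𝓛^{⊗d})`). [folklore] -/
theorem isSection_aeval (hs : ∀ i, E.IsSection (s i)) {e : ℕ} {F : MvPolynomial (Fin (N + 1)) K}
    (hF : F.IsHomogeneous e) : (e • E).IsSection (aeval s F) := by
  classical
  -- the monomials `∏ sᵢ^{mᵢ}` are sections of `(deg m) • E`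
  have key : ∀ m : Fin (N + 1) →₀ ℕ, (m.degree • E).IsSection (m.prod fun i k => s i ^ k) := by
      intro m
      induction m using Finsupp.induction with
      | zero =>
        intro i x hx
        simp only [Finsupp.prod_zero_index, mul_one]
        change IsRegularAt x (E.f i ^ 0)
        rw [pow_zero]; exact isRegularAt_one
      | single_add a b f ha hb ih =>
        rw [Finsupp.prod_add_index' (h := fun i k => s i ^ k) (fun _ => pow_zero _)
            (fun _ _ _ => pow_add _ _ _),
          Finsupp.prod_single_index (h := fun i k => s i ^ k) (pow_zero _), map_add,
          Finsupp.degree_single]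
        have h1 : ((1 * b) • E).IsSection (s a ^ b) := IsSection.pow E (by rw [one_smul]; exact hs a) b
        rw [one_mul] at h1
        exact h1.mul E ih
  induction hF using MvPolynomial.IsWeightedHomogeneous.induction_on with
  | zero => rw [map_zero]; exact isSection_zero _
  | add p q _ _ hp hq =>
    rw [map_add]
    exact ((e • E).sections K).add_mem hp hq
  | monomial m r hm =>
    rw [MvPolynomial.aeval_monomial, ← Algebra.smul_def]
    have hdeg : m.degree = e := by rw [Finsupp.degree_eq_weight_one]; exact hm
    rw [← hdeg]
    exact ((m.degree • E).sections K).smul_mem r (key m)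

/-! ### The non-vanishing locus of `F(s)` -/

section Locus

variable (hs : ∀ i, E.IsSection (s i)) (hξ : ∀ i, genericPoint X ∈ E.nonvanishingOpens (s i))
  (hcov : ∀ x : X, ∃ i, x ∈ E.nonvanishing (s i))

/-- Notation-free abbreviation for the generating sections of `s₀, …, s_N`. -/
local notation "G" => E.toGeneratingSections s hs hξ hcov

/-- **The chart ring map read in `K(X)`**: on the chart `X_{s_j} → D₊(x_j)`, the ring map
`K[x] → Γ(X_{s_j}, 𝒪)`, `x_{j'} ↦ s_{j'}/s_j` (`GeneratingSections.chartFun`) sends `F` to a section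
whose rational function is `F(s₀/s_j, …, s_N/s_j)`. [folklore] -/
theorem ofSection_chartFun (j : Fin (N + 1)) (F : MvPolynomial (Fin (N + 1)) K) :
    ofSection (hξ j) ((E.nonvanishingOpens (s j)).topIso.hom
      ((G).chartFun (X ↘ Spec (.of K)) j (E.nonvanishingOpens (s j)).ι
        (GeneratingSections.top_le_ι_preimage _) F)) =
      eval₂ (algebraMap K X.functionField) (fun j' => s j' / s j) F := by
  -- both sides are ring homomorphisms `K[x] → K(X)`; compare on `C c` and `X j'`
  set T : X.Opens := E.nonvanishingOpens (s j) with hT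
  let φ : MvPolynomial (Fin (N + 1)) K →+* X.functionField :=
    ((X.presheaf.germ T (genericPoint X) (hξ j)).hom.comp T.topIso.hom.hom).comp
      ((G).chartFun (X ↘ Spec (.of K)) j T.ι (GeneratingSections.top_le_ι_preimage _))
  change φ F = eval₂Hom (algebraMap K X.functionField) (fun j' => s j' / s j) F
  congr 1
  refine MvPolynomial.ringHom_ext (fun c => ?_) (fun j' => ?_)
  · rw [MvPolynomial.coe_eval₂Hom, MvPolynomial.eval₂_C]
    change ofSection (hξ j) (T.topIso.hom ((G).chartFun (X ↘ Spec (.of K)) j T.ι _ (C c))) = _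
    rw [GeneratingSections.chartFun_C, pull_comp, RingHom.comp_apply, pull_apply,
      Scheme.Opens.topIso_hom_appTop]
    change ofSection (hξ j) (X.presheaf.map (homOfLE le_top).op _) = _
    rw [ofSection_map, algebraMap_stalk_apply]
  · rw [MvPolynomial.coe_eval₂Hom, MvPolynomial.eval₂_X]
    change ofSection (hξ j) (T.topIso.hom ((G).chartFun (X ↘ Spec (.of K)) j T.ι _
      (MvPolynomial.X j'))) = _
    rw [GeneratingSections.chartFun_X]
    change ofSection (hξ j) (T.topIso.hom (GeneratingSections.res T.ι T
      (GeneratingSections.top_le_ι_preimage_of_le le_rfl) ((G).ratio j j'))) = _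
    rw [GeneratingSections.topIso_hom_res le_rfl, ofSection_map]
    exact E.germ_ratio s hs hξ j j' (hξ j)

/-- **`X_{F(s)} = ψ⁻¹ D₊(F)` pointwise**: for a form `F` of degree `e ≥ 1`, a point `x` lies in the
non-vanishing locus of the section `F(s)` of `𝒪_X(e E)` iff `F ∉ ψ(x)` (the homogeneous prime), where
`ψ : X → ℙ^N` is defined by `s₀, …, s_N` (Görtz–Wedhorn I, (13.11), p. 495: `r⁻¹(D₊(f)) = X_f`). Both
conditions say, on a chart `X_{s_j} ∋ x`, that `F(s)/s_jᵉ = F(s₀/s_j, …, s_N/s_j)` is a unit at `x`.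
[cite: GortzWedhorn2020, (13.11) p. 495] -/
theorem mem_nonvanishing_aeval_iff {e : ℕ} (he : 0 < e) {F : MvPolynomial (Fin (N + 1)) K}
    (hF : F ∈ grading (Fin (N + 1)) K e) (x : X) :
    x ∈ (e • E).nonvanishing (aeval s F) ↔
      F ∉ ((G).toProj (X ↘ Spec (.of K)) x).asHomogeneousIdeal := by
  obtain ⟨j, hxj⟩ := hcov x
  set T : X.Opens := E.nonvanishingOpens (s j) with hT
  have hxT : x ∈ T := hxj
  have hsj : s j ≠ 0 := ne_zero_of_mem_nonvanishing hxj
  -- the value `F(s/s_j)` and its relation to `F(s)`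
  have hval : eval₂ (algebraMap K X.functionField) (fun j' => s j' / s j) F = (s j)⁻¹ ^ e * aeval s F := by
    have : (fun j' => s j' / s j) = fun j' => (s j)⁻¹ * s j' := by
      funext j'; rw [div_eq_inv_mul]
    rw [this, eval₂_mul_left_of_isHomogeneous _ _ _ ((MvPolynomial.mem_homogeneousSubmodule e F).1 hF)]
    rfl
  -- (1) the right-hand side read in the chart `X_{s_j} → D₊(x_j)`
  have hg : ⊤ ≤ T.ι ⁻¹ᵁ (G).U j := GeneratingSections.top_le_ι_preimage _
  have hψ : (G).toProj (X ↘ Spec (.of K)) x =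
      (G).chartMap (X ↘ Spec (.of K)) j T.ι hg ⟨x, hxT⟩ := by
    rw [← (G).comp_toProj (X ↘ Spec (.of K)) T.ι hg]; rfl
  have hF1 : F ^ 1 ∈ grading (Fin (N + 1)) K e := by rw [pow_one]; exact hF
  have hrhs : F ∉ ((G).toProj (X ↘ Spec (.of K)) x).asHomogeneousIdeal ↔
      (⟨x, hxT⟩ : T) ∈ (T : Scheme.{u}).basicOpen ((G).chartFun (X ↘ Spec (.of K)) j T.ι hg F) := by
    rw [← Proj.mem_basicOpen (𝒜 := grading (Fin (N + 1)) K), hψ]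
    change (⟨x, hxT⟩ : T) ∈ (G).chartMap (X ↘ Spec (.of K)) j T.ι hg ⁻¹ᵁ
      Proj.basicOpen (grading (Fin (N + 1)) K) F ↔ _
    rw [GeneratingSections.chartMap, Scheme.Hom.comp_preimage, Scheme.Hom.comp_preimage,
      Proj.awayι_preimage_basicOpen _ (X_mem K j) zero_lt_one hF he,
      SpecMap_preimage_basicOpen, Scheme.toSpecΓ_preimage_basicOpen]
    change (⟨x, hxT⟩ : T) ∈ (T : Scheme.{u}).basicOpen ((G).chartRingHom (X ↘ Spec (.of K)) j T.ι hg
      (Away.mk _ (X_mem K j) e (F ^ 1) (by simpa using hF1))) ↔ _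
    rw [GeneratingSections.chartRingHom_awayMk, pow_one]
  -- (2) basic opens of `T` versus units in `K(X)`
  have hbasic : ∀ σ : Γ(T, ⊤), (⟨x, hxT⟩ : T) ∈ (T : Scheme.{u}).basicOpen σ ↔
      IsUnitAt x (ofSection (hξ j) (T.topIso.hom σ)) := by
    intro σ
    rw [isUnitAt_ofSection_iff hxT]
    have e1 : X.basicOpen (T.topIso.hom σ) = T.ι ''ᵁ (T : Scheme.{u}).basicOpen σ := by
      rw [← Scheme.Opens.ι_image_basicOpen_topIso_inv, ← CommRingCat.comp_apply, Iso.hom_inv_id]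
      rfl
    rw [e1]
    constructor
    · rintro hmem
      exact ⟨⟨x, hxT⟩, hmem, rfl⟩
    · rintro ⟨y, hy, hyx⟩
      have : y = ⟨x, hxT⟩ := Subtype.ext hyx
      rwa [this] at hy
  rw [hrhs, hbasic, ofSection_chartFun, hval]
  -- (3) the left-hand side on the chart `E.U i ∋ x`
  obtain ⟨i, hxi⟩ := E.covers x
  have hu : IsUnitAt x (E.f i * s j) := (E.mem_nonvanishing_iff hxi).1 hxj
  rw [(e • E).mem_nonvanishing_iff (i := i) hxi]
  change IsUnitAt x (E.f i ^ e * aeval s F) ↔ _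
  have e2 : E.f i ^ e * aeval s F = (E.f i * s j) ^ e * ((s j)⁻¹ ^ e * aeval s F) := by
    rw [mul_pow, inv_pow, mul_assoc, ← mul_assoc (s j ^ e), mul_inv_cancel₀ (pow_ne_zero _ hsj),
      one_mul]
  rw [e2]
  refine ⟨fun h => ?_, fun h => (hu.pow e).mul h⟩
  have := (hu.pow e).inv.mul h
  rwa [← mul_assoc, inv_mul_cancel₀ (pow_ne_zero _ hu.ne_zero), one_mul] at this

/-- **`X_{F(s)} = ψ⁻¹ D₊(F)` as opens** (Görtz–Wedhorn I, (13.11), p. 495). [cite: GortzWedhorn2020, (13.11) p. 495] -/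
theorem nonvanishingOpens_aeval_eq_preimage {e : ℕ} (he : 0 < e) {F : MvPolynomial (Fin (N + 1)) K}
    (hF : F ∈ grading (Fin (N + 1)) K e) :
    (e • E).nonvanishingOpens (aeval s F) =
      (G).toProj (X ↘ Spec (.of K)) ⁻¹ᵁ Proj.basicOpen (grading (Fin (N + 1)) K) F := by
  ext x
  change x ∈ (e • E).nonvanishing (aeval s F) ↔
    (G).toProj (X ↘ Spec (.of K)) x ∈ Proj.basicOpen (grading (Fin (N + 1)) K) F
  rw [Proj.mem_basicOpen]
  exact E.mem_nonvanishing_aeval_iff hs hξ hcov he hF x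

include hs hξ hcov in
/-- **`X_{F(s)}` is affine** when the non-vanishing loci `X_{s_j}` are affine: then `ψ : X → ℙ^N` is
an affine morphism (`GeneratingSections.isAffineHom_toProj`) and `X_{F(s)} = ψ⁻¹ D₊(F)` with `D₊(F)`
affine (Görtz–Wedhorn I, (13.11), p. 495, and Prop. 13.47). [cite: GortzWedhorn2020, (13.11) p. 495] -/
theorem isAffineOpen_nonvanishingOpens_aeval (haff : ∀ i, IsAffineOpen (E.nonvanishingOpens (s i)))
    {e : ℕ} (he : 0 < e) {F : MvPolynomial (Fin (N + 1)) K} (hF : F ∈ grading (Fin (N + 1)) K e) :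
    IsAffineOpen ((e • E).nonvanishingOpens (aeval s F)) := by
  rw [E.nonvanishingOpens_aeval_eq_preimage hs hξ hcov he hF]
  haveI : IsAffineHom ((G).toProj (X ↘ Spec (.of K))) :=
    GeneratingSections.isAffineHom_toProj _ _ haff
  exact (Proj.isAffineOpen_basicOpen _ F hF he).preimage _

end Locus

end CartierDivisor

end Literature.AlgebraicGeometry.Motives

end
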